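import Summits.AtomisticToContinuum.Crystallization.Theses.GappedShellCensus

/-!
# No shell point has three mutually bonded shell neighbours

Worker lemma `stub_noNbrTriangle` of the crux `GappedShellCensus.ShellTrichotomy`
(line `Sketch`, census half).

If four vectors `p q r s` of `ℝ³` all have norm in `[0.98, 1.02]` and are pairwise at distance
in `[0.98, 1.02]`, we derive `False`: together with the centre `0` they would be five points of
`ℝ³` pairwise at distance within `2 %` of `1`, a slightly perturbed regular `4`-simplex, and such
a simplex does not fit into a `3`-dimensional space.

Proof (folklore linear algebra). The hypotheses pin the Gram data:
`⟪v, v⟫ ∈ [0.9604, 1.0404]` and `⟪v, w⟫ ∈ [0.4402, 0.5602]` for distinct `v, w ∈ {p, q, r, s}`.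
Hence the Gram quadratic form `(a, b, c, d) ↦ ‖a • p + b • q + c • r + d • s‖ ²` dominates
`0.2802 (a² + b² + c² + d²)`, so it is positive definite. On the other hand four vectors of the
`3`-dimensional space `ℝ³` are linearly dependent, which produces a nontrivial zero of this form.
-/

noncomputable section

namespace Summit.AtomisticToContinuum.Crystallization.Theorems

open scoped RealInnerProductSpace

/-- The square of a real number in `[49/50, 51/50]` lies in `[2401/2500, 2601/2500]`. -/
private lemma noNbrTriangle_sq_window {t : ℝ} (h : 1 - 1 / 50 ≤ t ∧ t ≤ 1 + 1 / 50) :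
    2401 / 2500 ≤ t ^ 2 ∧ t ^ 2 ≤ 2601 / 2500 := by
  obtain ⟨h1, h2⟩ := h
  constructor <;> nlinarith

/-- The self inner product of a shell vector lies in `[2401/2500, 2601/2500]`. -/
private lemma noNbrTriangle_inner_self_window {x : EuclideanSpace ℝ (Fin 3)}
    (hx : 1 - 1 / 50 ≤ ‖x‖ ∧ ‖x‖ ≤ 1 + 1 / 50) :
    2401 / 2500 ≤ ⟪x, x⟫ ∧ ⟪x, x⟫ ≤ 2601 / 2500 := by
  rw [real_inner_self_eq_norm_sq]
  exact noNbrTriangle_sq_window hx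

/-- The inner product of two bonded shell vectors lies in `[2201/5000, 2801/5000]`
(polarisation: `2 ⟪x, y⟫ = ‖x‖² + ‖y‖² - ‖x - y‖²`). -/
private lemma noNbrTriangle_inner_window {x y : EuclideanSpace ℝ (Fin 3)}
    (hx : 1 - 1 / 50 ≤ ‖x‖ ∧ ‖x‖ ≤ 1 + 1 / 50) (hy : 1 - 1 / 50 ≤ ‖y‖ ∧ ‖y‖ ≤ 1 + 1 / 50)
    (hxy : 1 - 1 / 50 ≤ dist x y ∧ dist x y ≤ 1 + 1 / 50) :
    2201 / 5000 ≤ ⟪x, y⟫ ∧ ⟪x, y⟫ ≤ 2801 / 5000 := by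
  rw [dist_eq_norm] at hxy
  have h := norm_sub_sq_real x y
  obtain ⟨hx1, hx2⟩ := noNbrTriangle_sq_window hx
  obtain ⟨hy1, hy2⟩ := noNbrTriangle_sq_window hy
  obtain ⟨hxy1, hxy2⟩ := noNbrTriangle_sq_window hxy
  constructor <;> linarith

/-- Lower bound for a diagonal Gram term `x² ⟪v, v⟫`. -/
private lemma noNbrTriangle_diag_bound {m : ℝ} (hm : 2401 / 2500 ≤ m ∧ m ≤ 2601 / 2500)
    (x : ℝ) : 2401 / 2500 * x ^ 2 ≤ x ^ 2 * m := by
  nlinarith [mul_nonneg (sub_nonneg.2 hm.1) (sq_nonneg x)]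

/-- Sign-free lower bound for an off-diagonal Gram term `2 x y ⟪v, w⟫`: writing
`⟪v, w⟫ = 0.5002 + δ` with `|δ| ≤ 0.06` and using `|x y| ≤ (x² + y²) / 2`. -/
private lemma noNbrTriangle_cross_bound {m : ℝ} (hm : 2201 / 5000 ≤ m ∧ m ≤ 2801 / 5000)
    (x y : ℝ) : 5002 / 5000 * (x * y) - 3 / 50 * (x ^ 2 + y ^ 2) ≤ 2 * (x * y * m) := by
  nlinarith [mul_nonneg (sub_nonneg.2 hm.1) (sq_nonneg (x + y)),
    mul_nonneg (sub_nonneg.2 hm.2) (sq_nonneg (x - y))]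

/-- Four vectors of `ℝ³` admit a vanishing linear combination with a nonzero coefficient. -/
private lemma noNbrTriangle_exists_comb (p q r s : EuclideanSpace ℝ (Fin 3)) :
    ∃ g : Fin 4 → ℝ, g 0 • p + g 1 • q + g 2 • r + g 3 • s = 0 ∧
      0 < g 0 ^ 2 + g 1 ^ 2 + g 2 ^ 2 + g 3 ^ 2 := by
  have hnot : ¬ LinearIndependent ℝ ![p, q, r, s] := by
    intro hli
    have h := hli.fintype_card_le_finrank
    rw [finrank_euclideanSpace_fin, Fintype.card_fin] at h
    omega
  obtain ⟨g, hg, i, hi⟩ := Fintype.not_linearIndependent_iff.1 hnot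
  refine ⟨g, ?_, ?_⟩
  · simpa [Fin.sum_univ_four] using hg
  · have hS : 0 < ∑ j, g j ^ 2 :=
      Finset.sum_pos' (fun j _ => sq_nonneg (g j)) ⟨i, Finset.mem_univ _, by positivity⟩
    simpa [Fin.sum_univ_four] using hS

/-- **No shell point has three mutually bonded shell neighbours.** If `p q r s : ℝ³` have norms
in `[0.98, 1.02]` and pairwise distances in `[0.98, 1.02]`, then `False`: the Gram form of
`p, q, r, s` is positive definite (its entries are pinned near those of a regular simplex), yet
four vectors of `ℝ³` are linearly dependent. -/
theorem stub_noNbrTriangle (p q r s : EuclideanSpace ℝ (Fin 3))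
    (hp : 1 - 1 / 50 ≤ ‖p‖ ∧ ‖p‖ ≤ 1 + 1 / 50) (hq : 1 - 1 / 50 ≤ ‖q‖ ∧ ‖q‖ ≤ 1 + 1 / 50)
    (hr : 1 - 1 / 50 ≤ ‖r‖ ∧ ‖r‖ ≤ 1 + 1 / 50) (hs : 1 - 1 / 50 ≤ ‖s‖ ∧ ‖s‖ ≤ 1 + 1 / 50)
    (hpq : 1 - 1 / 50 ≤ dist p q ∧ dist p q ≤ 1 + 1 / 50) (hpr : 1 - 1 / 50 ≤ dist p r ∧ dist p r ≤ 1 + 1 / 50)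
    (hps : 1 - 1 / 50 ≤ dist p s ∧ dist p s ≤ 1 + 1 / 50) (hqr : 1 - 1 / 50 ≤ dist q r ∧ dist q r ≤ 1 + 1 / 50)
    (hqs : 1 - 1 / 50 ≤ dist q s ∧ dist q s ≤ 1 + 1 / 50) (hrs : 1 - 1 / 50 ≤ dist r s ∧ dist r s ≤ 1 + 1 / 50) :
    False := by
  obtain ⟨g, hg, hS⟩ := noNbrTriangle_exists_comb p q r s
  -- the four scalar relations `⟪v, g 0 • p + g 1 • q + g 2 • r + g 3 • s⟫ = 0`
  have e1 : g 0 * ⟪p, p⟫ + g 1 * ⟪p, q⟫ + g 2 * ⟪p, r⟫ + g 3 * ⟪p, s⟫ = 0 := by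
    have h : ⟪p, g 0 • p + g 1 • q + g 2 • r + g 3 • s⟫ = 0 := by rw [hg, inner_zero_right]
    simpa only [inner_add_right, real_inner_smul_right] using h
  have e2 : g 0 * ⟪p, q⟫ + g 1 * ⟪q, q⟫ + g 2 * ⟪q, r⟫ + g 3 * ⟪q, s⟫ = 0 := by
    have h : ⟪q, g 0 • p + g 1 • q + g 2 • r + g 3 • s⟫ = 0 := by rw [hg, inner_zero_right]
    simpa only [inner_add_right, real_inner_smul_right, real_inner_comm p q] using h
  have e3 : g 0 * ⟪p, r⟫ + g 1 * ⟪q, r⟫ + g 2 * ⟪r, r⟫ + g 3 * ⟪r, s⟫ = 0 := by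
    have h : ⟪r, g 0 • p + g 1 • q + g 2 • r + g 3 • s⟫ = 0 := by rw [hg, inner_zero_right]
    simpa only [inner_add_right, real_inner_smul_right, real_inner_comm p r,
      real_inner_comm q r] using h
  have e4 : g 0 * ⟪p, s⟫ + g 1 * ⟪q, s⟫ + g 2 * ⟪r, s⟫ + g 3 * ⟪s, s⟫ = 0 := by
    have h : ⟪s, g 0 • p + g 1 • q + g 2 • r + g 3 • s⟫ = 0 := by rw [hg, inner_zero_right]
    simpa only [inner_add_right, real_inner_smul_right, real_inner_comm p s,
      real_inner_comm q s, real_inner_comm r s] using h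
  -- the Gram quadratic form vanishes at `g`
  have quad : g 0 ^ 2 * ⟪p, p⟫ + g 1 ^ 2 * ⟪q, q⟫ + g 2 ^ 2 * ⟪r, r⟫ + g 3 ^ 2 * ⟪s, s⟫
      + 2 * (g 0 * g 1 * ⟪p, q⟫) + 2 * (g 0 * g 2 * ⟪p, r⟫) + 2 * (g 0 * g 3 * ⟪p, s⟫)
      + 2 * (g 1 * g 2 * ⟪q, r⟫) + 2 * (g 1 * g 3 * ⟪q, s⟫) + 2 * (g 2 * g 3 * ⟪r, s⟫) = 0 := by
    linear_combination g 0 * e1 + g 1 * e2 + g 2 * e3 + g 3 * e4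
  -- pinned Gram entries give a positive lower bound `0.2802 (Σ g_i²) ≤ 0`
  have d0 := noNbrTriangle_diag_bound (noNbrTriangle_inner_self_window hp) (g 0)
  have d1 := noNbrTriangle_diag_bound (noNbrTriangle_inner_self_window hq) (g 1)
  have d2 := noNbrTriangle_diag_bound (noNbrTriangle_inner_self_window hr) (g 2)
  have d3 := noNbrTriangle_diag_bound (noNbrTriangle_inner_self_window hs) (g 3)
  have c01 := noNbrTriangle_cross_bound (noNbrTriangle_inner_window hp hq hpq) (g 0) (g 1)
  have c02 := noNbrTriangle_cross_bound (noNbrTriangle_inner_window hp hr hpr) (g 0) (g 2)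
  have c03 := noNbrTriangle_cross_bound (noNbrTriangle_inner_window hp hs hps) (g 0) (g 3)
  have c12 := noNbrTriangle_cross_bound (noNbrTriangle_inner_window hq hr hqr) (g 1) (g 2)
  have c13 := noNbrTriangle_cross_bound (noNbrTriangle_inner_window hq hs hqs) (g 1) (g 3)
  have c23 := noNbrTriangle_cross_bound (noNbrTriangle_inner_window hr hs hrs) (g 2) (g 3)
  nlinarith [sq_nonneg (g 0 + g 1 + g 2 + g 3)]

end Summit.AtomisticToContinuum.Crystallization.Theorems
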